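import Summits.PneNP.PneNP.Theses.RamseyUncertifiable

/-!
# Sketch — first lemmas for crux ideas on `RegularResolutionRung` (stmt-PneNP-9818)

Scratch file of planner-cruxidea-stmt-PneNP-9818-3-0 (crux-ideate round 1, ideator 3).
Nothing here is proved; every `def … : Prop` is a candidate statement that must ELABORATE.
-/

namespace Summit.PneNP.PneNP.Cruxes.RegularResolutionRung.Sketch

open scoped Classical
open Literature.Computability.MetaComplexity Literature.Computability.Complexity

noncomputable section

/-- The unary clique CNF `Clique(G,k)` of the crux, verbatim (blocks `i < k`, variable of
`(i,v)` is `i * n + v`; clique-member, functionality and edge clauses). -/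
def cliqueCNF (n k : ℕ) (adj : Fin n → Fin n → Bool) : CNF ℕ :=
  ((List.range k).map fun i => (List.finRange n).map fun v => (i * n + (v : ℕ), true)) ++
  ((List.range k).flatMap fun i => (List.finRange n).flatMap fun u =>
      (List.finRange n).flatMap fun v =>
        if u < v then [[(i * n + (u : ℕ), false), (i * n + (v : ℕ), false)]] else []) ++
  ((List.range k).flatMap fun i => (List.range k).flatMap fun j =>
      (List.finRange n).flatMap fun u => (List.finRange n).flatMap fun v =>
        if i ≠ j ∧ adj u v = false then [[(i * n + (u : ℕ), false), (j * n + (v : ℕ), false)]]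
        else [])

/-- Minimal regular refutation length is at least `L`: every regular resolution refutation of
`Clique(G,k)` (unary, as in the crux) has length `≥ L`. -/
def RegularCliqueLengthGE {n : ℕ} (G : SimpleGraph (Fin n)) (k : ℕ) (L : ℝ) : Prop :=
  ∀ π : List (ResLine ℕ),
    IsResRefutation (cliqueCNF n k fun u v => decide (G.Adj u v)) π → IsRegular π →
      L ≤ (π.length : ℝ)

/-! ## Idea A — Kwan–Sudakov richness + certified random paths -/

/-- Two-sided `(δ, ρ, α)`-richness (Kwan–Sudakov 2020; Kwan–Sah–Sauermann–Sawhney 2023,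
Def. 4.3): for every vertex set `W` with `|W| ≥ δ m`, at most `m ^ α` vertices `v` have
`|N(v) ∩ W| ≤ ρ |W|` or `|W \ N(v)| ≤ ρ |W|`. -/
def IsRich {m : ℕ} (H : SimpleGraph (Fin m)) (δ ρ α : ℝ) : Prop :=
  ∀ W : Finset (Fin m), δ * (m : ℝ) ≤ (W.card : ℝ) →
    (((Finset.univ : Finset (Fin m)).filter fun v =>
        ((W.filter fun w => H.Adj v w).card : ℝ) ≤ ρ * W.card ∨
        ((W.filter fun w => ¬ H.Adj v w).card : ℝ) ≤ ρ * W.card).card : ℝ) ≤ (m : ℝ) ^ α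

/-- KNOWN (Kwan–Sudakov 2020, Lemma; KSSS 2023 Lemma 4.4), specialised to `m = √n`:
every `C`-Ramsey graph has a rich induced subgraph of polynomial size. Unproved in the tree;
to be vendored as a Literature fact. -/
def RamseyRichCore : Prop :=
  ∀ C α : ℝ, 0 < C → 0 < α → ∃ ρ : ℝ, 0 < ρ ∧ ρ < 1 ∧ ∃ n₀ : ℕ, ∀ n ≥ n₀,
    ∀ G : SimpleGraph (Fin n),
      G.CliqueFree ⌈C * Real.logb 2 n⌉₊ → Gᶜ.CliqueFree ⌈C * Real.logb 2 n⌉₊ →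
        ∃ m : ℕ, Real.sqrt n ≤ m ∧ ∃ f : Fin m ↪ Fin n,
          IsRich (G.comap f) ((Real.sqrt n / n) ^ ρ) ρ α

/-- FIRST LEMMA of idea A (the transferred crux C⁺, no Ramsey theory inside):
two-sided rich graphs are hard for regular resolution at every logarithmic clique size. -/
def RichCoreRegularHard : Prop :=
  ∀ α ρ θ κ : ℝ, 0 < α → α < 1 / 4 → 0 < ρ → ρ < 1 / 2 → 0 < θ → θ < 1 / 2 → 2 ≤ κ →
    ∃ c : ℝ, 0 < c ∧ ∃ m₀ : ℕ, ∀ m ≥ m₀, ∀ k : ℕ,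
      2 * Real.logb 2 m ≤ k → (k : ℝ) ≤ κ * Real.logb 2 m →
        ∀ H : SimpleGraph (Fin m), IsRich H ((m : ℝ) ^ (-θ)) ρ α →
          RegularCliqueLengthGE H k ((m : ℝ) ^ (c * Real.logb 2 m))

/-- SUPPORT (Fact 2.1 of Atserias et al. for this encoding): regular refutations restrict to
induced subgraphs without growing. -/
def RestrictionMonotone : Prop :=
  ∀ n m k : ℕ, ∀ (G : SimpleGraph (Fin n)) (f : Fin m ↪ Fin n) (π : List (ResLine ℕ)),
    IsResRefutation (cliqueCNF n k fun u v => decide (G.Adj u v)) π → IsRegular π →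
      ∃ π' : List (ResLine ℕ),
        IsResRefutation (cliqueCNF m k fun u v => decide ((G.comap f).Adj u v)) π' ∧
        IsRegular π' ∧ π'.length ≤ π.length

/-! ## Idea B — supergraph-monotone trace diversity (converse of ABdRLNR Prop. 3.1) -/

/-- The trace family `I(G) = { N̂(R) : R a clique of G }` (common neighbourhoods of cliques),
whose cardinality times `k² n²` upper-bounds regular refutation size (ABdRLNR Prop. 3.1). -/
def cliqueTraces {n : ℕ} (G : SimpleGraph (Fin n)) : Finset (Finset (Fin n)) :=
  ((Finset.univ : Finset (Fin n)).powerset.filter fun R => G.IsClique (R : Set (Fin n))).image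
    fun R => (Finset.univ : Finset (Fin n)).filter fun v => ∀ u ∈ R, G.Adj u v

/-- FIRST LEMMA of idea B (graph-theoretic, plausibly provable now from supersaturation +
two-sided richness): Ramsey graphs at the Erdős threshold have `n^{Ω(log n)}` distinct
clique traces. -/
def TraceDiversity : Prop :=
  ∃ c : ℝ, 0 < c ∧ ∃ n₀ : ℕ, ∀ n ≥ n₀, ∀ G : SimpleGraph (Fin n),
    G.CliqueFree (Nat.clog 2 (n ^ 2)) → Gᶜ.CliqueFree (Nat.clog 2 (n ^ 2)) →
      (n : ℝ) ^ (c * Real.logb 2 n) ≤ ((cliqueTraces G).card : ℝ)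

/-- CRUX of idea B (new, bold): the homomorphism/supergraph method of ABdRLNR §3 is complete
up to a polynomial — every regular refutation is at least a fixed power of the trace count of
SOME `K_k`-free supergraph. -/
def SupergraphTraceBound : Prop :=
  ∃ c₀ : ℝ, 0 < c₀ ∧ ∃ d : ℕ, ∀ n k : ℕ, ∀ G : SimpleGraph (Fin n), G.CliqueFree k →
    ∀ π : List (ResLine ℕ),
      IsResRefutation (cliqueCNF n k fun u v => decide (G.Adj u v)) π → IsRegular π →
        ∃ G' : SimpleGraph (Fin n), G ≤ G' ∧ G'.CliqueFree k ∧
          ((cliqueTraces G').card : ℝ) ^ c₀ ≤ (π.length : ℝ) * (n : ℝ) ^ d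

/-- Sanity: the two items of idea B give the single-sided (hence the max-form) crux shape. -/
def CruxSingleSided : Prop :=
  ∃ ε : ℝ, 0 < ε ∧ ∃ n₀ : ℕ, ∀ n ≥ n₀, ∀ G : SimpleGraph (Fin n),
    G.CliqueFree (Nat.clog 2 (n ^ 2)) → Gᶜ.CliqueFree (Nat.clog 2 (n ^ 2)) →
      RegularCliqueLengthGE G (Nat.clog 2 (n ^ 2)) ((n : ℝ) ^ (ε * Real.logb 2 n))

end

end Summit.PneNP.PneNP.Cruxes.RegularResolutionRung.Sketch
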